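import Summits.BirchSwinnertonDyer.BirchSwinnertonDyer.Theorems.SignedLowerHalvesKobayashiLowerHalfSemistablePW21CubeRoots
import Literature.NumberTheory.Automorphic.BrandtIndexReducedNorm
import Literature.NumberTheory.Automorphic.BrandtDataTransport
import Literature.NumberTheory.Automorphic.EichlerOrdersGenusLeftOrders
import Literature.NumberTheory.Automorphic.BrandtMatrixUnitCount
import Literature.NumberTheory.Automorphic.BrandtMatrixClassFunction
import Literature.NumberTheory.Automorphic.BrandtEichlerLevelUOperators
import Literature.NumberTheory.Automorphic.DefiniteOrderUnitsFinite
import HarnessLib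

/-!
# Stub `stub_pollackWestonLemma21` of line «defmu», crux 2 `KobayashiLowerHalfSemistable` (stmt-BirchSwinnertonDyer-19000) —
# part 2/3: sub-ideals fixed by a cube root of unity are principal; the Brandt columns of a class with `3 ∣ w_c` are
# `≡ (ℓ + 1) e_c (mod 3)` off the diagonal

Route-independent `Theorems` file (cell `b2b-bsdres`, seat `b2b-bsdres-x10b` = class owner X6, gen 41); part 2 of the series
proving Pollack–Weston 2011 Lemma 2.1 (part 1: `…PW21CubeRoots.lean`; part 3: `…DefmuPollackWestonLemma21.lean`).
HONEST FRAMING: prove what is provable now; shrink each hard class to its core with data; no claim beyond stated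
classes. Nothing about any curve is asserted and NO summit statement is proved here; BSD is not proved by any of this.

The Brandt-module form of "the cokernel `⊕_c ℤ/w_c` of Gross's pairing `⟨e_c, e_d⟩ = w_c δ_cd` on `ℤ[Cls O]` is an
Eisenstein Hecke module" at the prime `3`: for a Brandt setup `S = (D, O)` of type `(N⁺, N⁻)` (`BrandtXi.lean`), a class
`j` with `3 ∣ w_j` and a prime `ℓ ∤ N⁺N⁻`,

  **`3 ∣ T(ℓ)_ij` for every `i ≠ j`** (`three_dvd_matrix_of_dvd_weight`),

where `T(ℓ)_ij = #{J ⊆ I_j : [I_j : J] = ℓ², [J] = i}` is the tree's Brandt matrix (Voight (41.1.1)). Proof: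
`3 ∣ w_j = |O_L(I_j)ˣ| / 2` gives a unit `u ∈ O_L(I_j)ˣ = Stab(I_j)` of order `3` (Cauchy), `u² + u + 1 = 0`; the cyclic
group `⟨u⟩` acts on the Brandt set by `J ↦ u J`, and a `3`-group acting without fixed points acts on a set of cardinality
`≡ 0 (mod 3)`. There are no fixed points in a class `i ≠ j` because **a `u`-fixed sub-ideal `J ⊆ I_j` of index `ℓ²` is
principal, `J = β I_j`** (`exists_eq_units_smul_rep_of_cubeRoot_fixed`): transporting along `J ↦ (J : I_j) = J I_j⁻¹`
(`BrandtDataTransport.lean`) to the Eichler order `R = O_L(I_j)` (`EichlerOrdersGenusLeftOrders.lean`) and reading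
`R / ℓ R ≅ M₂(𝔽_ℓ)` through a matrix residue map `ψ` (part 1), the sub-ideals of index `ℓ²` are the `M_L`, `L` a line of
`𝔽_ℓ²` (`ResidueSubidealCount.lean`); `u M_L ⊆ M_L` makes `L` an eigenline of the NON-SCALAR matrix `g = ψ u` (part 1),
`L = ker (g - a)` with `a² + a + 1 = 0` (`exists_eigenvalue_of_cubeRoot_fixed`); then `u - a'` (`a' = -1 - a`) and `ℓ` lie
in `M_L`, and Thue's lemma (part 1) produces `β = m + n u ∈ M_L` of reduced norm `m² - m n + n² = ℓ`, whence `M_L = β R` by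
comparing indices (`exists_eq_units_smul_of_cubeRoot_fixed`).

## References

* B. H. Gross, *Heights and the special values of L-series*, CMS Conf. Proc. 7 (1987), §§1–3 [Gross1987].
* R. Pollack, T. Weston, Compos. Math. 147 (2011), §2.1 Lemma 2.1, §6.3 [PollackWeston2011].
* J. Voight, *Quaternion Algebras*, GTM 288 (2021), (41.1.1), 41.1.3 [Voight2021].
* M.-F. Vignéras, LNM 800 (1980), Ch. III §5 B [VignerasLNM800].
-/

noncomputable section

open scoped Pointwise Matrix TensorProduct

open Literature.NumberTheory.Automorphic

universe u

-- D-0017: single-problem summit, the namespace repeats the problem name by design.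
set_option linter.dupNamespace false

namespace Summit.BirchSwinnertonDyer.BirchSwinnertonDyer.Theorems.PollackWestonLemma21

variable {B : Type u} [Ring B] [Algebra ℚ B] [IsQuaternionAlgebra ℚ B]

/-! ### Sub-ideals of index `ℓ²` fixed by a cube root of unity are principal -/

/-- **Step 1 (eigenline).** Let `M = M_L ⊆ O` be the sub-ideal of index `ℓ²` attached to the line
`L ⊆ 𝔽_ℓ²` by the residue map `ψ`, and suppose `u M ⊆ M` for `u ∈ O` with `u² + u + 1 = 0`. Then
`L` is an eigenline of `g = ψ u`: there is `a ∈ 𝔽_ℓ` with `a² + a + 1 = 0` and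
`L = ker (g - a)`, the full `a`-eigenspace (which is a line because `g` is not a scalar). [folklore] -/
theorem exists_eigenvalue_of_cubeRoot_fixed {O : Submodule ℤ B} (hO : IsZOrder O) {ℓ : ℕ} [Fact ℓ.Prime] {ψ : B → Matrix (Fin 2) (Fin 2) (ZMod ℓ)}
    (h : IsMatrixResidueMap O ℓ ψ) {u : B} (hu : u ∈ O) (hcube : u * u + u + 1 = 0)
    {M : Submodule ℤ B} (hMO : M ≤ O) (hmul : ∀ m ∈ M, ∀ a ∈ O, m * a ∈ M)
    (hidx : M.toAddSubgroup.relIndex O.toAddSubgroup = ℓ ^ 2) (hfix : ∀ m ∈ M, u * m ∈ M) :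
    ∃ a : ZMod ℓ, a ^ 2 + a + 1 = 0 ∧
      M = h.idealOf (LinearMap.ker (Matrix.toLin' (ψ u) - a • LinearMap.id)) := by
  have hℓ : ℓ.Prime := Fact.out
  obtain ⟨hL1, hML⟩ := h.finrank_eq_one_and_eq_idealOf hO hℓ (ZMod.card ℓ) hMO hmul hidx
  set J := h.imageOf hMO hmul with hJ
  set L := MatrixRightIdeal.colSpan J with hLdef
  set g := ψ u with hg
  -- `g² + g + 1 = 0`
  have hg2 : g * g + g + 1 = 0 := by
    have h1 : ψ (u * u + u + 1) = g * g + g + 1 := by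
      rw [h.map_add _ (O.add_mem (hO.mul_mem u hu u hu) hu) 1 hO.one_mem,
        h.map_add _ (hO.mul_mem u hu u hu) u hu, h.map_mul u hu u hu, h.map_one]
    rw [← h1, hcube, h.map_zero]
  -- a spanning vector `v₀` of the line `L`
  obtain ⟨v, hv0, hvspan⟩ := (finrank_eq_one_iff' (K := ZMod ℓ)).mp hL1
  set v₀ : Fin 2 → ZMod ℓ := (v : Fin 2 → ZMod ℓ) with hv₀
  have hv₀L : v₀ ∈ L := v.2
  have hv₀0 : v₀ ≠ 0 := fun h0 => hv0 (Subtype.ext h0)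
  -- `g v₀ ∈ L`: the rank-one matrix `v₀ ⊗ e₀` lies in `ψ(M)`, and `M` is `u`-stable
  have hgv : g *ᵥ v₀ ∈ L := by
    have hA : Matrix.vecMulVec v₀ (Pi.single 0 1) ∈ J :=
      MatrixRightIdeal.vecMulVec_mem_of_mem_colSpan hv₀L _
    obtain ⟨m₀, hm₀, hm₀A⟩ := (h.mem_imageOf_iff hMO hmul).mp hA
    have hum : ψ (u * m₀) ∈ J := (h.mem_imageOf_iff hMO hmul).mpr ⟨u * m₀, hfix m₀ hm₀, rfl⟩
    rw [h.map_mul u hu m₀ (hMO hm₀), hm₀A] at hum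
    have := MatrixRightIdeal.mulVec_mem_colSpan hum (Pi.single 0 1)
    rwa [← Matrix.mulVec_mulVec, Matrix.vecMulVec_mulVec, dotProduct_single_one, Pi.single_eq_same,
      MulOpposite.op_one, one_smul] at this
  obtain ⟨a, ha⟩ := hvspan ⟨g *ᵥ v₀, hgv⟩
  have hgv₀ : g *ᵥ v₀ = a • v₀ := by
    have := congrArg Subtype.val ha
    simpa [hv₀] using this.symm
  -- `a² + a + 1 = 0`
  have ha2 : a ^ 2 + a + 1 = 0 := by
    have h1 : (g * g + g + 1) *ᵥ v₀ = (a ^ 2 + a + 1) • v₀ := by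
      rw [Matrix.add_mulVec, Matrix.add_mulVec, Matrix.one_mulVec, ← Matrix.mulVec_mulVec, hgv₀,
        Matrix.mulVec_smul, hgv₀, smul_smul, add_smul, add_smul, one_smul, sq]
    rw [hg2, Matrix.zero_mulVec] at h1
    exact (smul_eq_zero.mp h1.symm).resolve_right hv₀0
  refine ⟨a, ha2, ?_⟩
  -- `L ≤ E_a = ker (g - a)` and `E_a ≠ ⊤` (`g` is not a scalar), so `L = E_a`
  set E : Submodule (ZMod ℓ) (Fin 2 → ZMod ℓ) := LinearMap.ker (Matrix.toLin' g - a • LinearMap.id)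
    with hE
  have hmemE : ∀ w, w ∈ E ↔ g *ᵥ w = a • w := fun w => by
    rw [hE, LinearMap.mem_ker, LinearMap.sub_apply, LinearMap.smul_apply, LinearMap.id_apply,
      Matrix.toLin'_apply, sub_eq_zero]
  have hLE : L ≤ E := by
    intro w hw
    obtain ⟨c, hc⟩ := hvspan ⟨w, hw⟩
    have hw' : w = c • v₀ := by
      have := congrArg Subtype.val hc; simpa [hv₀] using this.symm
    rw [hmemE, hw', Matrix.mulVec_smul, hgv₀, smul_smul, smul_smul, mul_comm]
  have hEtop : E ≠ ⊤ := by
    intro htop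
    apply residue_cubeRoot_ne_smul_one hO h hu hcube a
    refine MatrixRightIdeal.eq_of_forall_mulVec_eq fun w => ?_
    have hw : w ∈ E := htop ▸ Submodule.mem_top
    rw [(hmemE w).mp hw, Matrix.smul_mulVec, Matrix.one_mulVec]
  have hEfin : Module.finrank (ZMod ℓ) E ≤ 1 := by
    have hlt : Module.finrank (ZMod ℓ) E < Module.finrank (ZMod ℓ) (⊤ : Submodule (ZMod ℓ) (Fin 2 → ZMod ℓ)) :=
      Submodule.finrank_lt_finrank_of_lt (lt_top_iff_ne_top.mpr hEtop)
    rw [finrank_top, Module.finrank_fin_fun] at hlt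
    omega
  have hLE' : L = E := Submodule.eq_of_le_of_finrank_le hLE (hL1 ▸ hEfin)
  rw [hML]
  change h.idealOf L = h.idealOf E
  rw [hLE']

/-- **Step 2 (principal generator). A right sub-`O`-module `M ⊆ O` of index `ℓ²` with `u M ⊆ M`
for a primitive cube root of unity `u ∈ O` is principal: `M = β O` with `β = m + n u ∈ ℤ[u]` of
reduced norm `ℓ`.** By Step 1, `M = M_{E_a}` for a root `a` of `x² + x + 1` in `𝔽_ℓ`; the element
`u - a'` (`a' = -1 - a` the other root, lifted to `ℤ`) lies in `M_{E_a}` since `(g - a)(g - a') = 0`,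
and so does `ℓ`; Thue's lemma gives `β = m + n u ∈ (u - a', ℓ) ⊆ M` with `nrd β = m² - mn + n² = ℓ`,
so `[O : β O] = ℓ² = [O : M]` and `M = β O`. [folklore] -/
theorem exists_eq_units_smul_of_cubeRoot_fixed (hdef : IsTotallyDefinite ℚ B)
    {O : Submodule ℤ B} (hO : IsZOrder O) {ℓ : ℕ} [Fact ℓ.Prime]
    {ψ : B → Matrix (Fin 2) (Fin 2) (ZMod ℓ)} (h : IsMatrixResidueMap O ℓ ψ) {u : B} (hu : u ∈ O)
    (hcube : u * u + u + 1 = 0) {M : Submodule ℤ B} (hMO : M ≤ O)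
    (hmul : ∀ m ∈ M, ∀ a ∈ O, m * a ∈ M) (hidx : M.toAddSubgroup.relIndex O.toAddSubgroup = ℓ ^ 2)
    (hfix : ∀ m ∈ M, u * m ∈ M) : ∃ β : Bˣ, (β : B) ∈ O ∧ M = β • O := by
  have hℓ : ℓ.Prime := Fact.out
  obtain ⟨a, ha2, hME⟩ := exists_eigenvalue_of_cubeRoot_fixed hO h hu hcube hMO hmul hidx hfix
  set g := ψ u with hg
  have h1O : (1 : B) ∈ O := hO.one_mem
  have hg2 : g * g + g + 1 = 0 := by
    have h1 : ψ (u * u + u + 1) = g * g + g + 1 := by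
      rw [h.map_add _ (O.add_mem (hO.mul_mem u hu u hu) hu) 1 h1O,
        h.map_add _ (hO.mul_mem u hu u hu) u hu, h.map_mul u hu u hu, h.map_one]
    rw [← h1, hcube, h.map_zero]
  have hmemE : ∀ w, w ∈ LinearMap.ker (Matrix.toLin' g - a • LinearMap.id) ↔ g *ᵥ w = a • w :=
    fun w => by
      rw [LinearMap.mem_ker, LinearMap.sub_apply, LinearMap.smul_apply, LinearMap.id_apply,
        Matrix.toLin'_apply, sub_eq_zero]
  -- the other root `a' = -1 - a`, lifted to `ã ∈ ℤ`
  set ã : ℤ := (((-1 - a : ZMod ℓ).val : ℕ) : ℤ) with hãdef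
  have hã : ((ã : ℤ) : ZMod ℓ) = -1 - a := by rw [hãdef, Int.cast_natCast, ZMod.natCast_zmod_val]
  have haa : a * (-1 - a) = 1 := by linear_combination (-1 : ZMod ℓ) * ha2
  have hℓdvd : (ℓ : ℤ) ∣ ã ^ 2 + ã + 1 := by
    rw [← ZMod.intCast_zmod_eq_zero_iff_dvd]; push_cast; rw [hã]; linear_combination ha2
  -- `u - ã • 1 ∈ M` and `ℓ • 1 ∈ M`
  have hℓ1M : (ℓ : ℤ) • (1 : B) ∈ M := by rw [hME]; exact h.smul_mem_preim _ h1O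
  have hmem1 : u - ã • (1 : B) ∈ M := by
    rw [hME]
    refine ⟨O.sub_mem hu (O.smul_mem _ h1O), ?_⟩
    rw [Submodule.mem_toAddSubgroup, MatrixRightIdeal.mem_rightIdealOf_iff]
    intro w
    rw [hmemE]
    have hψ : ψ (u - ã • (1 : B)) = g - (-1 - a) • (1 : Matrix (Fin 2) (Fin 2) (ZMod ℓ)) := by
      rw [h.map_sub hu (O.smul_mem _ h1O), h.map_zsmul h1O, h.map_one,
        ← Int.cast_smul_eq_zsmul (ZMod ℓ), hã]
    have hgg : g * g = -g - 1 := by rw [← sub_eq_zero, ← hg2]; noncomm_ring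
    rw [hψ, Matrix.sub_mulVec, Matrix.smul_mulVec, Matrix.one_mulVec, Matrix.mulVec_sub,
      Matrix.mulVec_smul, Matrix.mulVec_mulVec, hgg, Matrix.sub_mulVec, Matrix.neg_mulVec,
      Matrix.one_mulVec, smul_sub, smul_smul, haa, one_smul]
    module
  -- Thue: `β = m + n u` with `nrd β = ℓ`, `β ∈ M`
  obtain ⟨m, n, hmn, hdvd⟩ := EisensteinNorm.exists_sq_sub_mul_add_sq_eq_prime hℓ hℓdvd
  obtain ⟨k, hk⟩ := hdvd
  set β : B := (m : ℤ) • (1 : B) + (n : ℤ) • u with hβ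
  have hβO : β ∈ O := O.add_mem (O.smul_mem _ h1O) (O.smul_mem _ hu)
  have hβM : β ∈ M := by
    have : β = (n : ℤ) • (u - ã • (1 : B)) + k • ((ℓ : ℤ) • (1 : B)) := by
      rw [hβ, smul_sub, smul_smul, smul_smul, show k * (ℓ : ℤ) = m + n * ã by rw [mul_comm]; exact hk.symm]
      module
    rw [this]
    exact M.add_mem (M.smul_mem _ hmem1) (M.smul_mem _ hℓ1M)
  obtain ⟨htu, hnu⟩ := trdZ_nrdZ_of_cubeRoot hO hu hcube
  have hnβ : nrdZ β = ℓ := by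
    have hmul1 : ((m : ℤ) • (1 : B)) * ((n : ℤ) • u) = (m * n : ℤ) • u := by
      rw [smul_mul_assoc, one_mul, smul_smul]
    rw [hβ, hO.nrdZ_add (O.smul_mem _ h1O) (O.smul_mem _ hu), hO.nrdZ_zsmul _ h1O,
      hO.nrdZ_zsmul _ hu, IsZOrder.nrdZ_one, hnu, IsZOrder.polZ, hO.trdZ_zsmul _ h1O, hO.trdZ_zsmul _ hu,
      IsZOrder.trdZ_one, htu, hmul1, hO.trdZ_zsmul _ hu, htu, ← hmn]
    ring
  have hβ0 : β ≠ 0 := by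
    intro h0
    rw [h0, IsZOrder.nrdZ_zero] at hnβ
    exact hℓ.ne_zero (by exact_mod_cast hnβ.symm)
  obtain ⟨βu, hβu⟩ := isUnit_of_isTotallyDefinite B hdef hβ0
  -- `βu • O ⊆ M`, both of index `ℓ²` in `O`
  have hle : βu • O ≤ M := by
    intro x hx
    rw [mem_units_smul_submodule_iff] at hx
    have hx' : x = β * (((βu⁻¹ : Bˣ) : B) * x) := by
      rw [← hβu, ← mul_assoc, Units.mul_inv, one_mul]
    rw [hx']
    exact hmul β hβM _ hx
  have hβleft : (βu : B) ∈ Brandt.leftOrder O := fun y hy => by rw [hβu]; exact hO.mul_mem β hβO y hy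
  have hidxβ : (βu • O).toAddSubgroup.relIndex O.toAddSubgroup = ℓ ^ 2 :=
    (Brandt.relIndex_units_smul_eq_sq_iff hdef hO.isFullLattice hβleft ℓ).mpr
      (by rw [hβu, ← hO.cast_nrdZ hβO, hnβ]; norm_cast)
  have hmulidx := AddSubgroup.relIndex_mul_relIndex (H := (βu • O).toAddSubgroup)
    (K := M.toAddSubgroup) (L := O.toAddSubgroup) hle hMO
  rw [hidx, hidxβ] at hmulidx
  have h1 : (βu • O).toAddSubgroup.relIndex M.toAddSubgroup = 1 :=
    Nat.eq_of_mul_eq_mul_right (pow_pos hℓ.pos 2) (by rw [hmulidx, one_mul])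
  exact ⟨βu, hβu ▸ hβO, le_antisymm (fun x hx => (AddSubgroup.relIndex_eq_one.mp h1) hx) hle⟩

/-! ### Brandt setups: sub-ideals of a class representative fixed by a cube root of unity -/

section Setups

open Literature.NumberTheory.Automorphic.Brandt

variable {Nplus Nminus : ℕ}

/-- A unit of order `3` in `Dˣ` is a primitive cube root of unity: `u² + u + 1 = 0` (in a division
algebra, `(u - 1)(u² + u + 1) = u³ - 1 = 0` with `u ≠ 1`). [folklore] -/
theorem cubeRoot_of_orderOf_eq_three (S : XiSetup Nplus Nminus) {u : S.Dˣ} (hu : orderOf u = 3) :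
    (u : S.D) * u + u + 1 = 0 := by
  have h3 : (u : S.D) ^ 3 = 1 := by
    rw [← Units.val_pow_eq_pow_val, ← hu, pow_orderOf_eq_one, Units.val_one]
  have hne : (u : S.D) ≠ 1 := by
    intro h1
    have : u = 1 := Units.ext h1
    rw [this, orderOf_one] at hu
    exact absurd hu (by norm_num)
  have hfac : ((u : S.D) - 1) * ((u : S.D) * u + u + 1) = 0 := by
    have : ((u : S.D) - 1) * ((u : S.D) * u + u + 1) = (u : S.D) ^ 3 - 1 := by noncomm_ring
    rw [this, h3, sub_self]
  obtain ⟨w, hw⟩ := isUnit_of_isTotallyDefinite S.D S.isTotallyDefinite (sub_ne_zero.mpr hne)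
  have := congrArg (fun x => ((w⁻¹ : S.Dˣ) : S.D) * x) hfac
  simpa only [← mul_assoc, ← hw, Units.inv_mul, one_mul, mul_zero] using this

/-- **A `3 ∣ w_j` class carries a unit of order `3`**: if `3` divides the weight
`w_j = |O_L(I_j)ˣ| / 2`, the stabiliser `Stab_{Dˣ}(I_j) = O_L(I_j)ˣ` (of order `2 w_j`) has an element
of order `3` (Cauchy). [folklore] -/
theorem exists_orderOf_eq_three_of_dvd_weight (S : XiSetup Nplus Nminus) (j : ClassSet S.O)
    (h3 : 3 ∣ weight S.O j) :
    ∃ u : S.Dˣ, u ∈ MulAction.stabilizer S.Dˣ j.rep ∧ orderOf u = 3 := by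
  have hcard : Nat.card (MulAction.stabilizer S.Dˣ j.rep) = 2 * weight S.O j :=
    card_stabilizer_eq_two_mul_unitIndex S.one_ne_neg_one j.rep
  have hpos : 0 < weight S.O j := S.one_le_weight j
  haveI : Finite (MulAction.stabilizer S.Dˣ j.rep) := Nat.finite_of_card_ne_zero (by rw [hcard]; omega)
  haveI : Fact (Nat.Prime 3) := ⟨Nat.prime_three⟩
  obtain ⟨x, hx⟩ := exists_prime_orderOf_dvd_card' 3 (G := MulAction.stabilizer S.Dˣ j.rep)
    (by rw [hcard]; exact Dvd.dvd.mul_left h3 2)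
  exact ⟨x, x.2, by rw [← hx, Subgroup.orderOf_coe]⟩

/-- **Transport to the left order.** Let `I_j` be a representative of the class `j`, `u` a unit with
`u I_j = I_j` and `u² + u + 1 = 0`, and `J ⊆ I_j` an invertible right `O`-ideal of index `ℓ²`
(`ℓ ∤ N⁺N⁻` prime) with `u J = J`. Then `J = β I_j` for some `β ∈ Dˣ`: the transporter
`(J : I_j)` is a `u`-stable right sub-module of index `ℓ²` of the Eichler order `O_L(I_j)` (transport
of `BrandtDataTransport`), hence principal by `IsZOrder.exists_eq_units_smul_of_cubeRoot_fixed`, and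
`J = (J : I_j) I_j = β O_L(I_j) I_j = β I_j`. [folklore] -/
theorem exists_eq_units_smul_rep_of_cubeRoot_fixed (S : XiSetup Nplus Nminus)
    (j : ClassSet S.O) {u : S.Dˣ} (hu : u ∈ MulAction.stabilizer S.Dˣ j.rep)
    (hcube : (u : S.D) * u + u + 1 = 0) {ℓ : ℕ} (hℓ : ℓ.Prime) (hℓN : ¬ ℓ ∣ Nplus * Nminus)
    {J : Submodule ℤ S.D} (hJinv : IsInvertibleRightIdeal S.O J) (hJle : J ≤ j.rep)
    (hidx : J.toAddSubgroup.relIndex j.rep.toAddSubgroup = ℓ ^ 2) (hfix : u • J = J) :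
    ∃ β : S.Dˣ, J = β • j.rep := by
  haveI : Fact ℓ.Prime := ⟨hℓ⟩
  have hdef := S.isTotallyDefinite
  have hdiv : ∀ x : S.D, x ≠ 0 → IsUnit x := fun x hx => isUnit_of_isTotallyDefinite S.D hdef hx
  have hZ : IsZOrder S.O := isZOrder_iff_isOrder.mpr S.isEichlerOrder.isOrder
  have hri : rightIdeals S.O = invertibleRightIdeals S.O :=
    rightIdeals_eq_invertibleRightIdeals_of_isTotallyDefinite hdef hZ
  have hI : IsInvertibleRightIdeal S.O j.rep := by
    have hj := j.rep_mem; rw [hri] at hj; exact hj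
  set R := leftOrderOf j.rep with hRdef
  have hR : IsZOrder R := hI.isZOrder_leftOrderOf
  have hRE : _root_.Literature.NumberTheory.Automorphic.IsEichlerOrder R Nplus :=
    isEichlerOrder_iff_brandt.mpr (S.isEichlerOrder_leftOrder_rep j)
  obtain ⟨ψ, hψ⟩ := exists_isMatrixResidueMap_of_isEichlerOrder hRE (p := ℓ)
    (fun h => hℓN (dvd_mul_of_dvd_left h Nminus))
    (S.nonempty_algEquiv_padic fun h => hℓN (dvd_mul_of_dvd_right h Nplus))
  have hustab : u • j.rep = j.rep := MulAction.mem_stabilizer_iff.mp hu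
  have huR : (u : S.D) ∈ R := (units_smul_le_iff_mem_leftOrder j.rep u).mp hustab.le
  -- the transporter `M = (J : I_j) ⊆ R`
  set M := transporterLeft j.rep J with hMdef
  have hMR : M ≤ R := fun x hx m hm => hJle (hx m hm)
  have hmul : ∀ m ∈ M, ∀ a ∈ R, m * a ∈ M := fun m hm a ha y hy => by
    rw [mul_assoc]; exact hm _ (ha y hy)
  have hidxM : M.toAddSubgroup.relIndex R.toAddSubgroup = ℓ ^ 2 := by
    rw [hRdef, ← transporterLeft_self, hMdef, relIndex_transporterLeft hdiv hZ hI hI hJinv hJle, hidx]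
  have hfixM : ∀ m ∈ M, (u : S.D) * m ∈ M := fun m hm y hy => by
    rw [mul_assoc]
    have hmy : m * y ∈ J := hm y hy
    have : u • (m * y) ∈ u • J := Submodule.smul_mem_pointwise_smul _ u J hmy
    rwa [hfix, Units.smul_def, smul_eq_mul] at this
  obtain ⟨β, -, hMβ⟩ := exists_eq_units_smul_of_cubeRoot_fixed hdef hR hψ huR hcube hMR hmul hidxM hfixM
  refine ⟨β, ?_⟩
  have hJM : J = M * j.rep := (transporterLeft_mul_eq hdiv hZ hI hJinv).symm
  have hRI : R * j.rep = j.rep := by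
    rw [hRdef, ← transporterLeft_self]; exact transporterLeft_mul_eq hdiv hZ hI hI
  rw [hJM, hMβ, ← units_smul_mul, hRI]

/-- **The Brandt-matrix columns of a `3 ∣ w_j` class are divisible by `3` off the diagonal.** For a
Brandt setup of type `(N⁺, N⁻)`, a prime `ℓ ∤ N⁺N⁻` and classes `i ≠ j` with `3 ∣ w_j`:
`3 ∣ T(ℓ)_ij = #{J ⊆ I_j : [I_j : J] = ℓ², [J] = i}`. The cyclic group generated by a unit `u` of
order `3` of `O_L(I_j)` acts on this Brandt set by `J ↦ u J` without fixed points (a fixed `J` would be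
`β I_j`, of class `j`), so the set has cardinality `≡ 0 (mod 3)`. This is the Brandt-module form of
"the quotient `M^∨/M = ⊕ ℤ/w_c` of Gross's pairing is Eisenstein at `3`". [folklore] -/
theorem three_dvd_matrix_of_dvd_weight (S : XiSetup Nplus Nminus) {ℓ : ℕ} (hℓ : ℓ.Prime)
    (hℓN : ¬ ℓ ∣ Nplus * Nminus) {i j : ClassSet S.O} (hij : i ≠ j) (h3 : 3 ∣ weight S.O j) :
    (3 : ℤ) ∣ matrix S.O ℓ i j := by
  classical
  haveI : IsAddTorsionFree S.D := S.isAddTorsionFree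
  obtain ⟨u, hustab, hu3⟩ := exists_orderOf_eq_three_of_dvd_weight S j h3
  have hcube := cubeRoot_of_orderOf_eq_three S hu3
  have hdef := S.isTotallyDefinite
  have hZ : IsZOrder S.O := isZOrder_iff_isOrder.mpr S.isEichlerOrder.isOrder
  have hIi : IsInvertibleRightIdeal S.O i.rep := by
    have hi := i.rep_mem
    rw [rightIdeals_eq_invertibleRightIdeals_of_isTotallyDefinite hdef hZ] at hi
    exact hi
  -- the Brandt set and the action of `⟨u⟩` on it
  set X : Set (Submodule ℤ S.D) := {J | J ≤ j.rep ∧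
    J.toAddSubgroup.relIndex j.rep.toAddSubgroup = ℓ ^ 2 ∧ ∃ α : S.Dˣ, J = α • i.rep} with hX
  have hTX : matrix S.O ℓ i j = (X.ncard : ℤ) := by rw [matrix, Matrix.of_apply]
  have hXfin : X.Finite := finite_brandtSet i j hℓ.ne_zero
  haveI : Finite X := hXfin.to_subtype
  set G := Subgroup.zpowers u with hG
  have hGle : G ≤ MulAction.stabilizer S.Dˣ j.rep := (Subgroup.zpowers_le).mpr hustab
  have hmemX : ∀ (g : G) (J : X), ((g : S.Dˣ) • (J : Submodule ℤ S.D)) ∈ X := fun g J => by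
    have hg : (g : S.Dˣ) • j.rep = j.rep := MulAction.mem_stabilizer_iff.mp (hGle g.2)
    obtain ⟨hJle, hJidx, α, hJα⟩ := J.2
    refine ⟨?_, ?_, ⟨(g : S.Dˣ) * α, by rw [hJα, mul_smul]⟩⟩
    · calc (g : S.Dˣ) • (J : Submodule ℤ S.D) ≤ (g : S.Dˣ) • j.rep :=
            (units_smul_le_units_smul_iff _).mpr hJle
        _ = j.rep := hg
    · rw [← hJidx, ← Brandt.relIndex_units_smul (g : S.Dˣ) (J : Submodule ℤ S.D) j.rep, hg]
  letI : MulAction G X :=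
    { smul := fun g J => ⟨(g : S.Dˣ) • (J : Submodule ℤ S.D), hmemX g J⟩
      one_smul := fun J => Subtype.ext (one_smul S.Dˣ (J : Submodule ℤ S.D))
      mul_smul := fun g g' J => Subtype.ext (mul_smul (g : S.Dˣ) (g' : S.Dˣ) (J : Submodule ℤ S.D)) }
  haveI : Fact (Nat.Prime 3) := ⟨Nat.prime_three⟩
  have hGp : IsPGroup 3 G := IsPGroup.of_card (n := 1) (by rw [hG, Nat.card_zpowers, hu3, pow_one])
  have hmod := hGp.card_modEq_card_fixedPoints X
  -- no fixed points
  have hempty : MulAction.fixedPoints G X = ∅ := by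
    refine Set.eq_empty_iff_forall_notMem.mpr fun J hJ => hij ?_
    have hfix : u • (J : Submodule ℤ S.D) = J :=
      congrArg Subtype.val (hJ ⟨u, Subgroup.mem_zpowers u⟩)
    obtain ⟨hJle, hJidx, α, hJα⟩ := J.2
    have hJinv : IsInvertibleRightIdeal S.O (J : Submodule ℤ S.D) := by
      rw [hJα]; exact IsInvertibleRightIdeal.units_smul α hIi
    obtain ⟨β, hβ⟩ :=
      exists_eq_units_smul_rep_of_cubeRoot_fixed S j hustab hcube hℓ hℓN hJinv hJle hJidx hfix
    -- `α I_i = β I_j`: the classes coincide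
    have hrel : i.rep = (α⁻¹ * β) • j.rep := by rw [mul_smul, ← hβ, hJα, inv_smul_smul]
    have hji : (Quotient.mk (rightClassSetoid S.O) ⟨j.rep, j.rep_mem⟩ : ClassSet S.O) =
        Quotient.mk (rightClassSetoid S.O) ⟨i.rep, i.rep_mem⟩ := Quotient.sound ⟨α⁻¹ * β, hrel⟩
    rw [ClassSet.mk_rep, ClassSet.mk_rep] at hji
    exact hji.symm
  have h0 : Nat.card (MulAction.fixedPoints G X) = 0 := by rw [hempty]; simp
  rw [h0, Nat.card_coe_set_eq] at hmod
  rw [hTX]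
  exact Int.natCast_dvd_natCast.mpr (Nat.modEq_zero_iff_dvd.mp hmod)

end Setups

end Summit.BirchSwinnertonDyer.BirchSwinnertonDyer.Theorems.PollackWestonLemma21

end
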